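import Summits.HubbardSuperconductivity.HubbardSuperconductivity.Theorems.AnisotropyChordTransferFibre3FinConvCell
import Summits.HubbardSuperconductivity.HubbardSuperconductivity.Theorems.AnisotropyChordTransferFibre3FinMHoleSound

/-!
# Route `AnisotropyChord` / H0 rotor rung: FIN layer 3c — the regime certificate with the CONVOLUTION evaluator, generic in the cell predicate, and its soundness

The per-cell check `mholeCellOK3` (`T⁺ = 3λ + S/N` with `S`, `N` from `SIv3`, `NIv3` of `…Fibre3FinConvCell`), a cell-list
checker `cellsAll ok` GENERIC in the cell predicate (so that later evaluators reuse `cover_all`), the certificate `mholeCheck3`,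
and ★ `mHole_nonneg_of_cells3`: `7 ≤ L`, `mholeCheck3 L cells = true`, `0 < Δ < 1` ⇒ every ground profile has `0 ≤ mHole L Δ f`.
Same chain as `mHole_nonneg_of_cells` (`…Fibre3FinMHoleSound`) with the evenness and swap symmetry of the explicit profile
(`groundF_swap`) feeding `mem_SIv3`. Per-`L` kernel facts follow in `…Fibre3FinMHoleL10*` etc.
Prover seat `hubbard-h0-rotor-p3` g4; helper for stmt-HubbardSuperconductivity-23918 (piece A of rung 19089; `--supports`, helper class).
WHAT THIS IS NOT: nothing here proves superconductivity in the Hubbard model; soundness of a FIN certificate for the regime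
clause of one conditional reduction. Tree imports only; no sorry.
-/

set_option linter.dupNamespace false
set_option autoImplicit false

noncomputable section

namespace Summit.HubbardSuperconductivity.HubbardSuperconductivity.Theorems.AnisotropyChord.Transfer.Fibre3

namespace FinCell

open scoped BigOperators
open Finset Hole2

variable (L : ℕ) [NeZero L]

/-! ## Layer 3c: the certificate (computable, zero data) -/

/-- `T⁺ = 3λ + S/N` on the cell, convolution form. [folklore] -/
def tplusIv3 (L : ℕ) (la lb : ℤ) : Iv :=
  iadd (iscale 3 (la, lb)) (imul (SIv3 L (fTab L la lb) (cellOracle1 L la lb)) (iinv (NIv3 L (fTab L la lb))))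

/-- one cell of the regime certificate, convolution form. [folklore] -/
def mholeCellOK3 (L : ℕ) (la lb : ℤ) : Bool :=
  groundCellCheck L la lb &&
    (decide ((deltaIv L la lb).2 < 0) ||
      (decide (0 < (NIv3 L (fTab L la lb)).1) && decide ((tplusIv3 L la lb).2 ≤ (boundIv L).1)))

/-- consecutive cells all pass a cell predicate `ok`. [folklore] -/
def cellsAll (ok : ℤ → ℤ → Bool) : List ℤ → Bool
  | [] => true
  | [_] => true
  | a :: b :: rest => ok a b && cellsAll ok (b :: rest)

/-- ★ the per-`L` regime certificate, convolution form: at least two points, starting at `0`, pairwise checked, last point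
`≥ lamTop L`. [folklore] -/
def mholeCheck3 (L : ℕ) (cells : List ℤ) : Bool :=
  decide (cells.head? = some 0) && decide (2 ≤ cells.length) && decide (lamTop L ≤ cellsLast cells)
    && cellsAll (mholeCellOK3 L) cells

/-! ## The generic cell cover -/

variable {L}

omit [NeZero L] in
/-- a point of `[a, last]` lies in some `ok` cell of `a :: b :: rest`. [folklore] -/
theorem cover_all (ok : ℤ → ℤ → Bool) : ∀ (rest : List ℤ) (a b : ℤ) (x : ℝ), cellsAll ok (a :: b :: rest) = true →
    (a : ℝ) ≤ x → x ≤ ((cellsLast (a :: b :: rest) : ℤ) : ℝ) →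
    ∃ c d : ℤ, ok c d = true ∧ (c : ℝ) ≤ x ∧ x ≤ (d : ℝ) := by
  intro rest
  induction rest with
  | nil =>
    intro a b x hok ha hb
    unfold cellsAll at hok
    rw [Bool.and_eq_true] at hok
    unfold cellsLast cellsLast at hb
    exact ⟨a, b, hok.1, ha, hb⟩
  | cons c rest ih =>
    intro a b x hok ha hb
    unfold cellsAll at hok
    rw [Bool.and_eq_true] at hok
    by_cases hxb : x ≤ (b : ℝ)
    · exact ⟨a, b, hok.1, ha, hxb⟩
    · push Not at hxb
      have hb' : x ≤ ((cellsLast (b :: c :: rest) : ℤ) : ℝ) := by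
        unfold cellsLast at hb; exact hb
      exact ih b c x hok.2 hxb.le hb'

/-! ## Soundness -/

variable (L)

/-- ★★ SOUNDNESS OF THE CONVOLUTION-FORM CERTIFICATE: `mholeCheck3 L cells = true` ⇒ `0 ≤ mHole L Δ f` for every ground
profile, every `0 < Δ < 1` (`7 ≤ L`). [folklore] -/
theorem mHole_nonneg_of_cells3 (hL : 7 ≤ L) (cells : List ℤ) (hchk : mholeCheck3 L cells = true)
    {Δ : ℝ} (hΔ0 : 0 < Δ) (hΔ1 : Δ < 1) :
    ∀ lam2 : ℝ, ∀ f : Tor L → ℝ, IsGroundTwoMagnon L Δ lam2 f → 0 ≤ mHole L Δ f := by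
  refine forall_ground_of_window_7 L hL hΔ0.le hΔ1 (fun _ f => 0 ≤ mHole L Δ f) ?_
  intro lam2 f hf hlam0 hlamle
  have hD := D_pos
  -- unpack the certificate
  unfold mholeCheck3 at hchk
  simp only [Bool.and_eq_true, decide_eq_true_eq] at hchk
  obtain ⟨⟨⟨hhead, hlen⟩, htop⟩, hok⟩ := hchk
  obtain ⟨a, b, rest, hcells⟩ : ∃ a b : ℤ, ∃ rest : List ℤ, cells = a :: b :: rest := by
    match cells, hlen with
    | a :: b :: rest, _ => exact ⟨a, b, rest, rfl⟩
  subst hcells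
  have ha0 : a = 0 := by simpa using hhead
  subst ha0
  -- locate the cell
  set x : ℝ := lam2 * ((D : ℤ) : ℝ) with hx
  have hx0 : ((0 : ℤ) : ℝ) ≤ x := by rw [hx]; push_cast; positivity
  have hxtop : x ≤ ((cellsLast ((0 : ℤ) :: b :: rest) : ℤ) : ℝ) :=
    (lam_mul_D_le_lamTop L (by omega) hlamle).trans (by exact_mod_cast htop)
  obtain ⟨c, d, hcell, hcx, hxd⟩ := cover_all (mholeCellOK3 L) rest 0 b x hok hx0 hxtop
  -- the explicit profile: even and swap-symmetric
  have hfe : f = groundF L lam2 := ground_eq_explicit L (by omega) hΔ0.le hΔ1 hf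
  have hΔe : Δ = deltaOfLam L lam2 := ground_delta_eq L (by omega) hΔ0.le hΔ1 hf
  have hf2 : IsTwoMagnon L Δ lam2 f := hf.1
  have hev : ∀ r : Tor L, f (-r) = f r := hf.2.1
  have hsw : ∀ r : Tor L, f (r.2, r.1) = f r := by
    intro r; rw [hfe]; exact groundF_swap lam2 r
  -- unpack the cell check
  unfold mholeCellOK3 at hcell
  simp only [Bool.and_eq_true, Bool.or_eq_true, decide_eq_true_eq] at hcell
  obtain ⟨hgc, hcase⟩ := hcell
  rcases hcase with hvac | ⟨hN, hT⟩
  · -- vacuous cell: Δ ≤ Δ_hi < 0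
    exfalso
    have hmd := mem_delta_cell L (by omega) hlam0 hcx hxd hgc
    rw [← hΔe] at hmd
    obtain ⟨_, hhi⟩ := hmd
    have : ((((deltaIv L c d).2 : ℤ)) : ℝ) < 0 := by exact_mod_cast hvac
    nlinarith
  · -- the main case
    have htab : TabEncl L f (fTab L c d) := by
      rw [hfe]; exact tabEncl_fTab (by omega) hlam0 hcx hxd hgc
    have horc : ∀ e1 e2 r1 r2 : ℕ, e1 < L → e2 < L → r1 < L → r2 < L →
        mem (Dgrad L f ((((e1 : ℕ) : ZMod L)), (((e2 : ℕ) : ZMod L))) ((((r1 : ℕ) : ZMod L)), (((r2 : ℕ) : ZMod L))))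
          (cellOracle1 L c d e1 e2 r1 r2) := by
      rw [hfe]; exact mem_cellOracle1 (by omega) hlam0 hcx hxd hgc
    have mN : mem (PiNormSq L f) (NIv3 L (fTab L c d)) := mem_NIv3 htab
    have mS : mem (∑ cc : Cfg L, piR L f cc * C0fn L Δ lam2 f cc) (SIv3 L (fTab L c d) (cellOracle1 L c d)) :=
      mem_SIv3 (by omega) hf2 hev hsw htab horc
    -- `N > 0`
    have hNpos : 0 < PiNormSq L f := by
      obtain ⟨hlo, _⟩ := mN
      have : (0 : ℝ) < (((NIv3 L (fTab L c d)).1 : ℤ) : ℝ) := by exact_mod_cast hN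
      nlinarith
    -- `T⁺ = 3λ + S/N`
    have hS := sum_piR_C0fn L hf2
    have hTeq : Tplus L Δ f = 3 * lam2 + (∑ cc : Cfg L, piR L f cc * C0fn L Δ lam2 f cc) * (1 / PiNormSq L f) := by
      rw [hS]; field_simp; ring
    have mT : mem (Tplus L Δ f) (tplusIv3 L c d) := by
      rw [hTeq]
      unfold tplusIv3
      have h3 : mem (3 * lam2) (iscale 3 (c, d)) := by
        have := mem_iscale 3 (mem_lam hcx hxd); push_cast at this; exact this
      exact mem_iadd h3 (mem_imul mS (mem_iinv mN hN))
    have mB := mem_bound L (by omega)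
    obtain ⟨_, hThi⟩ := mT
    obtain ⟨hBlo, _⟩ := mB
    have hle : ((((tplusIv3 L c d).2 : ℤ)) : ℝ) ≤ ((((boundIv L).1 : ℤ)) : ℝ) := by exact_mod_cast hT
    unfold mHole
    nlinarith

end FinCell

end Summit.HubbardSuperconductivity.HubbardSuperconductivity.Theorems.AnisotropyChord.Transfer.Fibre3

end
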